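import Literature.Topology.FourManifolds.MappingTorusSliver
import Literature.Topology.FourManifolds.CircleSurgeryLocal
import Literature.Topology.FourManifolds.NeckCapping
import HarnessLib

/-!
# Regluing a surgered mapping torus across a fibre sliver

Third brick of the geometric core of R. Gompf, *More Cappell–Shaneson spheres are standard*,
Algebr. Geom. Topol. 10 (2010), Theorem 2.1, towards the named facts
`Literature.Topology.FourManifolds.gompf2010_framedTwist` /
`Literature.Topology.FourManifolds.gompf2010_framedTwistZero`: the surgered version of
`MappingTorusSliver.lean`. Let `T` be a mapping torus of `φ` and `T'` one of `g ∘ φ` (open gluings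
of the cylinders `M × (0, 1)`, `M × (1/2, 3/2)` with witnesses `jA, jB`, resp. `jA', jB'`), `g`
supported in `S`, and let `Θ : T ∖ jB (S × {1}) ≅ T' ∖ jB' (S × {1})` be the sliver
diffeomorphism (`IsOpenGluingWith.exists_sliverDiffeomorph`). Let `ν` be a tube of a circle `c`
in `T` missing the sliver and `ν' = Θ ∘ ν` the transported tube of `c' = Θ ∘ c` in `T'`, and
`Ψ : (T ∖ sliver) surgered ≅ (T' ∖ sliver) surgered` the induced diffeomorphism of the surgered
open sets (`CircleNbhd.exists_diffeomorph_localOpens`, `CircleSurgeryLocal.lean`). Then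
(`Literature.Topology.FourManifolds.IsOpenGluingWith.sliver_reglue_surgered`):

**the surgered manifold `ν'.Surgered` of `T'` is an open gluing of the surgered-and-cut manifold
`(T ∖ jB (S × {1}))` surgered along `ν` and of the punctured second cylinder
`(M ∖ {p₀}) × (1/2, 3/2)` (`p₀` the point of `M` through which the circle runs), along the
relation "reglue by `g` across the fibre": `x ∼ (y, t) :⟺ (y, t) ∉ S × {1} ∧
x = inl (jB (sliverTwist g⁻¹ (y, t)))`.**

This is Gompf's description of `X^ε_{φ∘δᵏ}` as "`X^ε_φ` cut along an `M`-fibre and reglued by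
`δᵏ`" (proof of Thm 2.1, last paragraph), in the tree's relational language; the relation only
involves the data of `T` (and `g`, `S`), so that Theorem 2.1 is reduced to exhibiting the *same*
open-gluing structure on `ν.Surgered` itself — which is what the fishtail neighbourhood and
Lemma 2.2 of loc. cit. provide (not in this file). No named facts are introduced; everything here
is proved.

## References

* R. E. Gompf, *More Cappell–Shaneson spheres are standard*, Algebr. Geom. Topol. 10 (2010)
  1665–1681: proof of Thm 2.1, last paragraph. [GompfAGT2010]
* R. E. Gompf, A. I. Stipsicz, *4-Manifolds and Kirby Calculus*, GSM 20 (1999), §5.2.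
  [GompfStipsiczGSM1999]
* A. Kosinski, *Differential Manifolds* (1993), Ch. VI §1. [Kosinski1993]
-/

open scoped Manifold ContDiff Topology
open Set Function

noncomputable section

namespace Literature.Topology.FourManifolds

universe u

/-- Local notation: `𝔼 n` is the model Euclidean space `EuclideanSpace ℝ (Fin n)`. -/
local notation "𝔼 " n:arg => EuclideanSpace ℝ (Fin n)

/-- Local notation: `𝕊 n` is the unit sphere in `EuclideanSpace ℝ (Fin (n + 1))`. -/
local notation "𝕊 " n:arg => (Metric.sphere (0 : EuclideanSpace ℝ (Fin (n + 1))) 1)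

attribute [local instance] fact_finrank_euclideanSpace_succ

/-! ### The punctured second cylinder and its embedding into the complement of the circle -/

section Punctured

variable {M : Type*} [TopologicalSpace M]

/-- **The punctured second cylinder `(M ∖ {p₀}) × (1/2, 3/2)`** as an open subset of the second
cylinder (`p₀` the base point through which the section circle runs). [folklore] -/
def puncturedCylTwo [T1Space M] (p₀ : M) : TopologicalSpace.Opens (M × ↥mappingTorusPieceTwo) :=
  ⟨{b | b.1 ≠ p₀}, (isClosed_singleton.preimage continuous_fst).isOpen_compl⟩

/-- Membership in the punctured cylinder. [folklore] -/
@[simp] theorem mem_puncturedCylTwo_iff [T1Space M] {p₀ : M} {b : M × ↥mappingTorusPieceTwo} :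
    b ∈ puncturedCylTwo p₀ ↔ b.1 ≠ p₀ :=
  Iff.rfl

variable {T' : Type u} [TopologicalSpace T'] [T2Space T'] [ChartedSpace (𝔼 4) T'] {c' : 𝕊 1 → T'}
  (ν' : CircleNbhd (𝓡 4) c') (jB' : M × ↥mappingTorusPieceTwo → T') [T1Space M] (p₀ : M)
  (hcB' : ∀ b, jB' b ∈ range c' → b.1 = p₀)

/-- **The punctured second cylinder inside the complement of the circle**: `(y, t) ↦ jB' (y, t)`
as a map `(M ∖ {p₀}) × (1/2, 3/2) → T' ∖ c'`, when the circle meets the second cylinder only over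
`p₀` (`hcB'`). [folklore] -/
def cylToComplement (b : ↥(puncturedCylTwo p₀)) : ↥ν'.complement :=
  ⟨jB' b, (ν'.mem_complement_iff _).2 fun hb ↦ b.2 (hcB' b hb)⟩

/-- The value of `cylToComplement`. [folklore] -/
@[simp] theorem coe_cylToComplement (b : ↥(puncturedCylTwo p₀)) :
    (cylToComplement ν' jB' p₀ hcB' b : T') = jB' b := rfl

variable {E H : Type*} [NormedAddCommGroup E] [NormedSpace ℝ E] [TopologicalSpace H]
  {I : ModelWithCorners ℝ E H} [ChartedSpace H M] [IsManifold I ∞ M] [IsManifold (𝓡 4) ∞ T']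

omit [T2Space T'] [IsManifold (𝓡 4) ∞ T'] in
/-- Restricting a smooth embedding of the second cylinder to the punctured cylinder gives a smooth
embedding. [folklore] -/
theorem isSmoothEmbedding_comp_val_puncturedCylTwo {jB' : M × ↥mappingTorusPieceTwo → T'}
    (hB' : Manifold.IsSmoothEmbedding (I.prod 𝓘(ℝ, ℝ)) (𝓡 4) ∞ jB') :
    Manifold.IsSmoothEmbedding (I.prod 𝓘(ℝ, ℝ)) (𝓡 4) ∞
      (jB' ∘ (Subtype.val : ↥(puncturedCylTwo p₀) → M × ↥mappingTorusPieceTwo)) := by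
  rcases isEmpty_or_nonempty ↥(puncturedCylTwo p₀) with hE | hne
  · exact ⟨Manifold.IsImmersionOfComplement.isImmersion (F := Unit) fun x ↦ isEmptyElim x,
      hB'.isEmbedding.comp Topology.IsEmbedding.subtypeVal⟩
  · have hΦ := hB'.comp_openPartialHomeomorph
      ((puncturedCylTwo p₀).openPartialHomeomorphSubtypeCoe hne) (by simp)
      (contMDiffOn_openPartialHomeomorphSubtypeCoe _ hne)
      (contMDiffOn_openPartialHomeomorphSubtypeCoe_symm _ hne)
    rwa [TopologicalSpace.Opens.openPartialHomeomorphSubtypeCoe_coe] at hΦ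

/-- **`cylToComplement` is a smooth embedding** when `jB'` is (restriction to an open subset of the
source, corestriction to an open subset of the target). [folklore] -/
theorem isSmoothEmbedding_cylToComplement
    (hB' : Manifold.IsSmoothEmbedding (I.prod 𝓘(ℝ, ℝ)) (𝓡 4) ∞ jB') :
    Manifold.IsSmoothEmbedding (I.prod 𝓘(ℝ, ℝ)) (𝓡 4) ∞ (cylToComplement ν' jB' p₀ hcB') :=
  (isSmoothEmbedding_comp_val_puncturedCylTwo p₀ hB').codRestrict_opens ν'.complement fun b ↦
    (ν'.mem_complement_iff _).2 fun hb ↦ b.2 (hcB' b hb)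

omit [IsManifold I ∞ M] [IsManifold (𝓡 4) ∞ T'] [ChartedSpace H M] in
/-- The range of `cylToComplement` is open when `jB'` is an open embedding. [folklore] -/
theorem isOpen_range_cylToComplement (hB' : Topology.IsOpenEmbedding jB') :
    IsOpen (range (cylToComplement ν' jB' p₀ hcB')) := by
  have hr : range (cylToComplement ν' jB' p₀ hcB') =
      Subtype.val ⁻¹' (jB' '' (puncturedCylTwo p₀ : Set (M × ↥mappingTorusPieceTwo))) := by
    ext a'
    constructor
    · rintro ⟨b, rfl⟩
      exact ⟨b, b.2, rfl⟩
    · rintro ⟨b, hbW, hb⟩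
      exact ⟨⟨b, hbW⟩, Subtype.ext hb⟩
  rw [hr]
  exact (hB'.isOpenMap _ (puncturedCylTwo p₀).2).preimage continuous_subtype_val

end Punctured

/-! ### The surgered regluing -/

section Surgered

variable {E H : Type*} [NormedAddCommGroup E] [NormedSpace ℝ E] [TopologicalSpace H]
  {I : ModelWithCorners ℝ E H} {M : Type*} [TopologicalSpace M] [ChartedSpace H M]
  [T1Space M] [IsManifold I ∞ M]
  {T T' : Type u} [TopologicalSpace T] [T2Space T] [ChartedSpace (𝔼 4) T] [IsManifold (𝓡 4) ∞ T]
  [TopologicalSpace T'] [T2Space T'] [ChartedSpace (𝔼 4) T'] [IsManifold (𝓡 4) ∞ T']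
  {φ : M → M} (g : M ≃ₘ⟮I, I⟯ M)
  {jA : M × ↥mappingTorusPieceOne → T} {jB : M × ↥mappingTorusPieceTwo → T}
  {jA' : M × ↥mappingTorusPieceOne → T'} {jB' : M × ↥mappingTorusPieceTwo → T'}

omit [T2Space T] [IsManifold (𝓡 4) ∞ T] in
/-- A point of the open tube is off the circle: `ν (w, t • v) ∉ c (𝕊¹)` for `t > 0`, `v ∈ 𝕊²`. [folklore] -/
theorem CircleNbhd.apply_smul_sphere_not_mem {c : 𝕊 1 → T} (ν : CircleNbhd (𝓡 4) c) (w : 𝕊 1)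
    {t : ℝ} (ht : 0 < t) (v : 𝕊 2) : ν.toFun (w, t • (v : 𝔼 3)) ∉ range c := by
  rw [ν.apply_mem_range_iff, smul_eq_zero, not_or]
  exact ⟨ht.ne', ne_zero_of_mem_unit_sphere v⟩

/-- **Regluing a surgered mapping torus across a fibre sliver** (Gompf 2010, proof of Thm 2.1,
last paragraph: "precede the surgery by cutting along an `M`-fiber and regluing by `δᵏ`"). With
`T` a mapping torus of `φ` (witnesses `jA, jB`), `T'` one of `g ∘ φ` (witnesses `jA', jB'`), `g`
supported in `S`, `Θ : T ∖ jB (S × {1}) ≅ T' ∖ jB' (S × {1})` the sliver diffeomorphism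
(`Θ ∘ jA = jA'`, `Θ ∘ jB = jB' ∘ sliverTwist g`; `IsOpenGluingWith.exists_sliverDiffeomorph`),
`ν` a tube of the circle `c` in `T` off the sliver, `ν' = Θ ∘ ν` a tube of `c'` in `T'`,
`Ψ` the induced diffeomorphism of the surgered open sets
(`CircleNbhd.exists_diffeomorph_localOpens`), and the circle `c'` meeting the second cylinder
exactly over the base point `p₀`: the surgered manifold `ν'.Surgered` of `T'` is an open gluing of
`(T ∖ jB (S × {1}))` surgered along `ν` and the punctured cylinder `(M ∖ {p₀}) × (1/2, 3/2)`, by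
`Ψ` and `inl' ∘ jB'`, along `x ∼ b :⟺ b ∉ S × {1} ∧ x = inl (jB (sliverTwist g⁻¹ b))`. The
relation only involves `T`, `ν`, `jB`, `g`, `S`. [cite: GompfAGT2010, Thm 2.1 (proof, last paragraph)] -/
theorem IsOpenGluingWith.sliver_reglue_surgered
    (h : IsOpenGluingWith (I.prod 𝓘(ℝ, ℝ)) (I.prod 𝓘(ℝ, ℝ)) (𝓡 4) (mappingTorusRel φ) jA jB)
    (h' : IsOpenGluingWith (I.prod 𝓘(ℝ, ℝ)) (I.prod 𝓘(ℝ, ℝ)) (𝓡 4) (mappingTorusRel (g ∘ φ))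
      jA' jB')
    {S : Set M} (hc : IsClosed (jB '' fibreSliver S)) (hc' : IsClosed (jB' '' fibreSliver S))
    (Θ : ↥(sliverCompl jB S hc) ≃ₘ⟮𝓡 4, 𝓡 4⟯ ↥(sliverCompl jB' S hc'))
    (hΘA : ∀ (u : ↥(sliverCompl jB S hc)) (a : M × ↥mappingTorusPieceOne),
      (u : T) = jA a → (Θ u : T') = jA' a)
    (hΘB : ∀ (u : ↥(sliverCompl jB S hc)) (b : M × ↥mappingTorusPieceTwo),
      (u : T) = jB b → (Θ u : T') = jB' (sliverTwist g b))
    {c : 𝕊 1 → T} (ν : CircleNbhd (𝓡 4) c) {c' : 𝕊 1 → T'} (ν' : CircleNbhd (𝓡 4) c')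
    (hνU : ∀ q, ν.toFun q ∈ sliverCompl jB S hc)
    (hΘν : ∀ q, ((Θ ⟨ν.toFun q, hνU q⟩ : ↥(sliverCompl jB' S hc')) : T') = ν'.toFun q)
    (Ψ : ↥(ν.localOpens (sliverCompl jB S hc)) ≃ₘ⟮𝓡 4, 𝓡 4⟯
      ↥(ν'.localOpens (sliverCompl jB' S hc')))
    (hΨl : ∀ (x : ↥(ν.localOpens (sliverCompl jB S hc))) (a : ↥ν.complement),
      (x : ν.Surgered) = ν.glueData.inl a →
        (Ψ x : ν'.Surgered) = ν'.glueData.inl (ν.complementExtend ν' Θ hνU hΘν a))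
    (hΨr : ∀ (x : ↥(ν.localOpens (sliverCompl jB S hc))) (d : ↥discTimesSphere),
      (x : ν.Surgered) = ν.glueData.inr d → (Ψ x : ν'.Surgered) = ν'.glueData.inr d)
    (p₀ : M) (hcB' : ∀ b, jB' b ∈ range c' → b.1 = p₀) (hcB'₀ : ∀ t, jB' (p₀, t) ∈ range c') :
    IsOpenGluingWith (𝓡 4) (I.prod 𝓘(ℝ, ℝ)) (𝓡 4)
      (fun (x : ↥(ν.localOpens (sliverCompl jB S hc))) (b : ↥(puncturedCylTwo p₀)) ↦
        (b : M × ↥mappingTorusPieceTwo) ∉ fibreSliver S ∧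
          ∃ a : ↥ν.complement, (a : T) = jB (sliverTwist g.symm b) ∧
            (x : ν.Surgered) = ν.glueData.inl a)
      (fun x ↦ (Ψ x : ν'.Surgered)) (ν'.glueData.inl ∘ cylToComplement ν' jB' p₀ hcB') := by
  have hSR := h.sliver_reglue g h' hc hc' Θ hΘA hΘB
  have hiff : ∀ (u : ↥(sliverCompl jB S hc)) (b : M × ↥mappingTorusPieceTwo),
      (Θ u : T') = jB' b ↔ b ∉ fibreSliver S ∧ (u : T) = jB (sliverTwist g.symm b) :=
    hSR.2.2.2.2.2
  obtain ⟨-, -, hB', hBo', -, -⟩ := h'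
  have hW := ν.glueData.isOpenGluingWith ν.circleSurgeryRel_iff
  have hW' := ν'.glueData.isOpenGluingWith ν'.circleSurgeryRel_iff
  refine ⟨(Manifold.IsSmoothEmbedding.of_opens (ν'.localOpens (sliverCompl jB' S hc'))).comp_diffeomorph Ψ, ?_,
    ν'.glueData.isSmoothEmbedding_inl_comp (isSmoothEmbedding_cylToComplement ν' jB' p₀ hcB' hB'),
    ?_, ?_, fun x b ↦ ?_⟩
  · -- the range of `x ↦ Ψ x` is the open set `localOpens ν' U'`
    have hr : range (fun x ↦ (Ψ x : ν'.Surgered)) = (ν'.localOpens (sliverCompl jB' S hc') : Set ν'.Surgered) := by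
      ext p
      constructor
      · rintro ⟨x, rfl⟩
        exact (Ψ x).2
      · intro hp
        exact ⟨Ψ.symm ⟨p, hp⟩, by
          show ((Ψ (Ψ.symm ⟨p, hp⟩) : ↥(ν'.localOpens (sliverCompl jB' S hc'))) : ν'.Surgered) = p
          rw [Diffeomorph.apply_symm_apply]⟩
    rw [hr]
    exact (ν'.localOpens (sliverCompl jB' S hc')).2
  · rw [range_comp]
    exact ν'.glueData.isOpenMap_inl _
      (isOpen_range_cylToComplement ν' jB' p₀ hcB' ⟨hB'.isEmbedding, hBo'⟩)
  · -- the two ranges cover `ν'.Surgered`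
    refine eq_univ_iff_forall.2 fun p ↦ ?_
    by_cases hp : p ∈ ν'.localOpens (sliverCompl jB' S hc')
    · exact Or.inl ⟨Ψ.symm ⟨p, hp⟩, by
        show ((Ψ (Ψ.symm ⟨p, hp⟩) : ↥(ν'.localOpens (sliverCompl jB' S hc'))) : ν'.Surgered) = p
        rw [Diffeomorph.apply_symm_apply]⟩
    · right
      rcases ν'.glueData.exists_inl_or_inr p with ⟨a', rfl⟩ | ⟨d, rfl⟩
      · have ha' : (a' : T') ∉ sliverCompl jB' S hc' := fun ha' ↦ hp (ν'.inl_mem_localOpens ha')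
        rw [mem_sliverCompl_iff, not_not] at ha'
        obtain ⟨b, hbS, hb⟩ := ha'
        have hb₀ : b.1 ≠ p₀ := by
          intro hb1
          have hmem : jB' b ∈ range c' := by
            have : b = (p₀, b.2) := Prod.ext hb1 rfl
            rw [this]
            exact hcB'₀ b.2
          exact ((ν'.mem_complement_iff _).1 a'.2) (hb ▸ hmem)
        refine ⟨⟨b, hb₀⟩, ?_⟩
        rw [comp_apply]
        congr 1
        exact Subtype.ext hb
      · exact absurd (ν'.inr_mem_localOpens d) hp
  · -- the relation
    show (Ψ x : ν'.Surgered) = ν'.glueData.inl (cylToComplement ν' jB' p₀ hcB' b) ↔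
      ((b : M × ↥mappingTorusPieceTwo) ∉ fibreSliver S ∧
        ∃ a : ↥ν.complement, (a : T) = jB (sliverTwist g.symm b) ∧
          (x : ν.Surgered) = ν.glueData.inl a)
    rcases (ν.mem_localOpens_iff).1 x.2 with ⟨a, ha, hxa⟩ | ⟨d, hxd⟩
    · -- `x = inl a` with `a ∈ U`
      rw [hΨl x a hxa.symm, ν'.glueData.inl_injective.eq_iff, Subtype.ext_iff,
        CircleNbhd.coe_complementExtend, coe_cylToComplement, CircleNbhd.extendMap_of_mem ν' Θ ha, hiff]
      refine and_congr_right fun _ ↦ ⟨fun h1 ↦ ⟨a, h1, hxa.symm⟩, ?_⟩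
      rintro ⟨a₁, ha₁, hx₁⟩
      rw [← hxa, ν.glueData.inl_injective.eq_iff] at hx₁
      subst hx₁
      exact ha₁
    · -- `x = inr d`
      rw [hΨr x d hxd.symm, eq_comm, hW'.2.2.2.2.2]
      constructor
      · rintro ⟨w, t, ht, hd, hq⟩
        rw [coe_cylToComplement, ← hΘν, eq_comm, hiff] at hq
        refine ⟨hq.1, ⟨ν.toFun (w, t • ((d : (𝔼 2) × (𝕊 2)).2 : 𝔼 3)),
          (ν.mem_complement_iff _).2 (ν.apply_smul_sphere_not_mem w ht.1 _)⟩, hq.2, ?_⟩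
        rw [← hxd, eq_comm, hW.2.2.2.2.2]
        exact ⟨w, t, ht, hd, rfl⟩
      · rintro ⟨hbS, a₁, ha₁, hx₁⟩
        rw [← hxd, eq_comm, hW.2.2.2.2.2] at hx₁
        obtain ⟨w, t, ht, hd, hq⟩ := hx₁
        refine ⟨w, t, ht, hd, ?_⟩
        rw [coe_cylToComplement, ← hΘν, eq_comm, hiff]
        refine ⟨hbS, ?_⟩
        change ν.toFun (w, t • ((d : (𝔼 2) × (𝕊 2)).2 : 𝔼 3)) = jB (sliverTwist g.symm b)
        rw [← hq]
        exact ha₁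

end Surgered

end Literature.Topology.FourManifolds
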